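import Literature.NumberTheory.LFunctions.Zhang2022.DetectorEntangledSOS
import Literature.NumberTheory.LFunctions.Zhang2022.DetectorAnchorKernel
import Literature.NumberTheory.LFunctions.Zhang2022.DetectorDoublingCompose

/-!
# Zhang (2022), programme F-S3 (cell landau-siegel §E): E-102 HEAD 1 — the entangled cone is positive
# semidefinite for every anchor `a ∈ (0,1)` and every real palette; with head 2, `Det.EdetPremise (0,1) (0,5)`

Y. Zhang, *Discrete mean estimates and the Landau–Siegel zero*, arXiv:2211.02515v1 [Zhang2022LandauSiegel] — an
unrefereed manuscript under adjudication. **WHAT THIS IS NOT: not a claim about Theorems 1–2 of arXiv:2211.02515, about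
Landau–Siegel zeros, or about Parity. What is proved is a statement about the programme's TYPED OBJECT
`Det.entangledMain` / `Det.ConePSD` / `Det.EdetPremise` (the (A)-main-term block form of the det family, registry E-102)
— «B-AH restricted to DET» as an in-house positivity question; nothing here asserts that this object IS the main term of
any discrete mean of the manuscript. «The programme SEARCHES and TYPES; no claim about Landau–Siegel zeros, Theorems 1–2
of arXiv:2211.02515 or a repaired Margin232 until a kernel theorem says so.»**

Assembly of the sum-of-squares route (cell desk note barrier/p2/R3a-ENTDBL-p2.md v2, ls-barrier-p2 g4; theory referee
PASS 2026-08-27T03:39:20Z): `(π/2)·Re entangledMain(a;b;h) = Σ_{jl} Re m₀(a,b_j,b_l)·𝔥_a(ũ_j,ũ_l) + Re 𝔅′(x_h,x_h)`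
(`Det.entangledMain_eq_uForm_add_boundaryBracket`, p495361), the bulk Gram sum is `≥ 0` by Picone + L-B′1
(`Det.conePSD_of_re_boundaryBracket_nonneg_jets`, p495361, reduces head 1 to `Re 𝔅′ ≥ 0` on jets), and the boundary
bracket is a sum of squares (`Det.entangledFreeEnd_sub_uBoundary_eq_sos`, DetectorEntangledSOS):
`𝔅′(x⃗,x⃗) = (π³/(4 sin θ))·(2a cos θ·Σ_{jl} Re m₀(a,b_j,b_l)·ω_j ω̄_l + |Σ_j L_j|²)`, `θ = πa/2` — non-negative real part by
L-B′1 (`Det.re_ddM0_sum_nonneg_complex`, p488885) and `|·|² ≥ 0`.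

* `re_boundaryBracket_nonneg` — `0 ≤ Re 𝔅′(a;b)(x⃗,x⃗)` for `a ∈ (0,1)`, every real palette, all jets;
* **`conePSD_of_mem_Ioo`** — `a ∈ (0,1) → ConePSD a b` for EVERY real palette `b : Fin K → ℝ` (no box);
* **`edetCone_unit : EdetCone (Set.Ioo 0 1) (Set.Ioo 0 5)`** (E-102 head 1, the row of record), `edetCone_of_Ioo B`;
* **`edetPremise_unit : EdetPremise (Set.Ioo 0 1) (Set.Ioo 0 5)`** — with head 2 (`Det.monomialConePSD_unit`, K6
  p490608, via `Det.edetPremise_unit_iff_edetCone`): the E-102 premise of the B-det word as a THEOREM about the typed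
  object. 0 facts, 0 sorry, standard axioms.
-/

noncomputable section

open Complex Real

namespace Literature.NumberTheory.LFunctions.Zhang2022

namespace Det

open scoped ComplexConjugate

variable {K : ℕ} {a : ℝ}

/-- `E(a) − E(a)⁻¹ = 2i·sin(πa/2)`. [cite: Zhang2022LandauSiegel, Prop 7.1 p.44 with (8.11)–(8.23)] -/
theorem halfExp_sub_inv (a : ℝ) : halfExp a - (halfExp a)⁻¹ = 2 * I * ((Real.sin (π * a / 2) : ℝ) : ℂ) := by
  rw [ofReal_sin_half]
  field_simp

/-- `E(a) + E(a)⁻¹ = 2·cos(πa/2)`. [cite: Zhang2022LandauSiegel, Prop 7.1 p.44 with (8.11)–(8.23)] -/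
theorem halfExp_add_inv (a : ℝ) : halfExp a + (halfExp a)⁻¹ = 2 * ((Real.cos (π * a / 2) : ℝ) : ℂ) := by
  rw [ofReal_cos_half]
  ring

/-- **The boundary bracket has non-negative real part** (`a ∈ (0,1)`, every real palette, all jets):
`Re 𝔅′(a;b)(x⃗,x⃗) = (π³/(4 sin θ))·(2a cos θ·Re Σ_{jl} Re m₀(a,b_j,b_l)·ω_jω̄_l + |Σ_j L_j|²) ≥ 0`, `θ = πa/2`,
`ω_j = x₂j/(iπ) + b_j x₁j` — L-B′1 for the first term, a modulus square for the second.
[cite: Zhang2022LandauSiegel, Prop 7.1 p.44 with (7.2), (8.11)–(8.23)] -/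
theorem re_boundaryBracket_nonneg (ha : a ∈ Set.Ioo (0:ℝ) 1) (b : Fin K → ℝ) (x₁ x₂ : Fin K → ℂ) :
    0 ≤ (boundaryBracket a b x₁ x₂ x₁ x₂).re := by
  have hπ : (π : ℂ) ≠ 0 := by exact_mod_cast Real.pi_ne_zero
  have hIπ : I * (π : ℂ) ≠ 0 := mul_ne_zero Complex.I_ne_zero hπ
  -- the jets in `(p, ω)` coordinates
  set ω : Fin K → ℂ := fun j => x₂ j / (I * π) + (b j : ℂ) * x₁ j with hω
  have hx₂ : ∀ j, I * π * (ω j - b j * x₁ j) = x₂ j := by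
    intro j; rw [hω]; field_simp; ring
  have key := entangledFreeEnd_sub_uBoundary_eq_sos a b x₁ ω
  simp only [hx₂] at key
  rw [← boundaryBracket_eq, halfExp_sub_inv, halfExp_add_inv] at key
  -- the angle
  have hθ0 : 0 < π * a / 2 := by have := mul_pos Real.pi_pos ha.1; linarith
  have hθ1 : π * a / 2 < π / 2 := by have := mul_lt_mul_of_pos_left ha.2 Real.pi_pos; linarith
  have hs : 0 < Real.sin (π * a / 2) := Real.sin_pos_of_pos_of_lt_pi hθ0 (by linarith [Real.pi_pos])
  have hc : 0 < Real.cos (π * a / 2) := Real.cos_pos_of_mem_Ioo ⟨by linarith, hθ1⟩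
  set S : ℂ := ∑ j, ∑ l, (((ddM0 ![a, b j, b l]).re : ℝ) : ℂ) * (ω j * conj (ω l)) with hS
  set N : ℂ := (∑ j, sosL a b x₁ ω j) * conj (∑ j, sosL a b x₁ ω j) with hN
  -- solve the identity for the bracket
  have hBB : boundaryBracket a b x₁ x₂ x₁ x₂
      = ((π ^ 3 / (4 * Real.sin (π * a / 2)) : ℝ) : ℂ) * (((2 * a * Real.cos (π * a / 2) : ℝ) : ℂ) * S + N) := by
    have hs' : ((Real.sin (π * a / 2) : ℝ) : ℂ) ≠ 0 := by exact_mod_cast hs.ne'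
    have hne : (2 : ℂ) * (2 * I * ((Real.sin (π * a / 2) : ℝ) : ℂ)) ≠ 0 :=
      mul_ne_zero two_ne_zero (mul_ne_zero (mul_ne_zero two_ne_zero Complex.I_ne_zero) hs')
    apply mul_left_cancel₀ hne
    rw [key]
    simp only [Complex.ofReal_div, Complex.ofReal_mul, Complex.ofReal_pow, Complex.ofReal_ofNat]
    field_simp
    ring
  -- the two non-negative pieces
  have hSre : 0 ≤ S.re := by
    have ha2 : a ∈ Set.Ioo (0:ℝ) 2 := ⟨ha.1, by linarith [ha.2]⟩
    have h := re_ddM0_sum_nonneg_complex ha2 b (fun j => conj (ω j))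
    have hSS : S = ∑ j, ∑ l, conj (conj (ω j)) * conj (ω l) * (((ddM0 ![a, b j, b l]).re : ℝ) : ℂ) := by
      rw [hS]
      refine Finset.sum_congr rfl fun j _ => Finset.sum_congr rfl fun l _ => ?_
      rw [Complex.conj_conj]; ring
    rw [hSS]; exact h
  have hNre : N.re = Complex.normSq (∑ j, sosL a b x₁ ω j) := by
    rw [hN, Complex.mul_conj, Complex.ofReal_re]
  rw [hBB, Complex.re_ofReal_mul, Complex.add_re, Complex.re_ofReal_mul, hNre]
  have h1 : 0 ≤ π ^ 3 / (4 * Real.sin (π * a / 2)) := by positivity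
  have h2 : 0 ≤ 2 * a * Real.cos (π * a / 2) := by have := ha.1; positivity
  exact mul_nonneg h1 (add_nonneg (mul_nonneg h2 hSre) (Complex.normSq_nonneg _))

/-- **E-102 HEAD 1 (every real palette, no box): the entangled cone is PSD for every anchor `a ∈ (0,1)`.**
`Re m(a;b;h) ≥ 0` for every `K`, every `b : Fin K → ℝ`, every one-sided kinked profile vector — sum of squares
(bulk Picone–Gram + boundary Gram) given L-B′1. [cite: Zhang2022LandauSiegel, Prop 7.1 p.44 with (7.2), (8.11)–(8.23)] -/
theorem conePSD_of_mem_Ioo (ha : a ∈ Set.Ioo (0:ℝ) 1) (b : Fin K → ℝ) : ConePSD a b :=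
  conePSD_of_re_boundaryBracket_nonneg_jets ha b (re_boundaryBracket_nonneg ha b)

/-- **E-102 head 1 on any shift box `B`** (the anchor law `a ∈ (0,1)` is the only condition).
[cite: Zhang2022LandauSiegel, Prop 7.1 p.44 with (7.2), (8.11)–(8.23)] -/
theorem edetCone_of_Ioo (B : Set ℝ) : EdetCone (Set.Ioo 0 1) B :=
  fun _ _ ha b _ => conePSD_of_mem_Ioo ha b

/-- **E-102 HEAD 1, the row of record: `EdetCone (0,1) (0,5)`.** [cite: Zhang2022LandauSiegel, Prop 7.1 p.44 with (7.2), (8.11)–(8.23)] -/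
theorem edetCone_unit : EdetCone (Set.Ioo 0 1) (Set.Ioo 0 5) :=
  edetCone_of_Ioo _

/-- **E-102 — the full premise of record `EdetPremise (0,1) (0,5)` as a THEOREM** (head 1 here; head 2 =
`Det.monomialConePSD_unit` by DOUBLING, K6). A statement about the programme's typed det-family main-term object; see
the module docstring for what it is NOT. [cite: Zhang2022LandauSiegel, §2 (2.13), Lemma 2.3 p.6; Prop 7.1 p.44 with (7.2), (8.11)–(8.23)] -/
theorem edetPremise_unit : EdetPremise (Set.Ioo 0 1) (Set.Ioo 0 5) :=
  edetPremise_unit_iff_edetCone.mpr edetCone_unit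

end Det

end Literature.NumberTheory.LFunctions.Zhang2022
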